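import Mathlib.Data.Nat.Pairing
import Mathlib.Data.Nat.Log
import Literature.Computability.Complexity.Classes
import HarnessLib

/-!
# Complexity meta: the arithmetic of the proof of Thm. 4.2 of Hirahara 2021 ("choosing the constant `d` large enough")

Topic `Literature/Computability/MetaComplexity`, part of the inline proof plan of
`Hirahara2021_languageCompression` (S. Hirahara, ECCC TR21-058 (2021), Thm. 4.2, proof on
pp. 28–29). Theorems only (elementary arithmetic over `ℕ`), isolated here so that the assembly file
stays readable. The printed proof chooses `k(t) := log A(1ᵗ) + d log t` and argues (p. 29): "Choosing
the constant `d` large enough (depending on `p_L` and `c'`), we have `t^{-d} + 1 - ⟨n,t⟩^{-c'} ≤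
1 - ⟨n,t⟩^{-c'}/2` for all large `t`." In the formalisation the slack is `Λ(t) = E(⌊log₂(t+2)⌋ + 1)`
(so `2^{Λ(t)} ≥ (t+2)^E`), the success of the heuristic is `1/q₁(ℓ + m)` for a polynomial `q₁` in
the sample length `ℓ = (n+1)k(t)` and the index `m = ⟨n, k(t), t⟩`, and the statement to arrange is
`2 q₁(ℓ + m) ≤ 2^{Λ(t)}` for `t ≥ T₀`:

* `exists_slack` — **for all polynomials `p_L, q_κ, q₁` there are `E, T₀` with
  `2 q₁((n+1)k + ⟨n,k,t⟩) ≤ (t+2)^E` whenever `t ≥ T₀`, `n ≤ p_L(t)` and `k ≤ q_κ(t) + E(t+3)`** (the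
  degree of the right-hand side is chosen one above that of the left-hand side, whose dependence on
  `E` is only through its leading constant; then `T₀` is that constant);
* small `Nat.log 2` facts used for the final polynomial `p` of Thm. 4.2: superadditivity
  `log a + log b ≤ log (ab)`, `E (log x) ≤ log (x^E)`, `log (2^c · y) ≥ c + log y`.

## References

* S. Hirahara, ECCC TR21-058 (2021), proof of Thm. 4.2 and of Claim 4.7 (pp. 28–29) [Hirahara2021].
* S. Arora, B. Barak, *Computational Complexity: A Modern Approach*, CUP 2009, Def. 1.13 (polynomials
  are dominated by single powers) [AroraBarakCC2009].
-/

namespace Literature.Computability.MetaComplexity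

open Polynomial Complexity

namespace LCBounds

/-! ### Logarithms -/

/-- Superadditivity of `⌊log₂⌋` on positive numbers: `log a + log b ≤ log (ab)`. [folklore] -/
theorem log_add_log_le {a b : ℕ} (ha : 0 < a) (hb : 0 < b) : Nat.log 2 a + Nat.log 2 b ≤ Nat.log 2 (a * b) := by
  refine Nat.le_log_of_pow_le one_lt_two ?_
  rw [pow_add]
  exact Nat.mul_le_mul (Nat.pow_log_le_self 2 ha.ne') (Nat.pow_log_le_self 2 hb.ne')

/-- `E · log x ≤ log (x^E)`. [folklore] -/
theorem mul_log_le_log_pow (E x : ℕ) : E * Nat.log 2 x ≤ Nat.log 2 (x ^ E) := by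
  rcases Nat.eq_zero_or_pos x with rfl | hx
  · rw [Nat.log_zero_right, mul_zero]; exact Nat.zero_le _
  induction E with
  | zero => simp only [zero_mul]; exact Nat.zero_le _
  | succ E ih =>
    rw [Nat.succ_mul, pow_succ]
    exact (Nat.add_le_add_right ih _).trans (log_add_log_le (pow_pos hx E) hx)

/-- `log (2^c · y) ≥ c + log y` for `y ≥ 1`. [folklore] -/
theorem add_log_le_log_two_pow_mul (c : ℕ) {y : ℕ} (hy : 0 < y) : c + Nat.log 2 y ≤ Nat.log 2 (2 ^ c * y) := by
  have h := log_add_log_le (pow_pos two_pos c) hy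
  rwa [Nat.log_pow one_lt_two] at h

/-- `1 + log x ≤ log (2x)` for `x ≥ 1`. [folklore] -/
theorem one_add_log_le_log_two_mul {x : ℕ} (hx : 0 < x) : 1 + Nat.log 2 x ≤ Nat.log 2 (2 * x) := by
  have h := log_add_log_le two_pos hx
  have h2 : Nat.log 2 2 = 1 := by simpa using Nat.log_pow one_lt_two 1
  rwa [h2] at h

/-! ### Polynomials are dominated by powers of `t + 2` -/

/-- Every `ℕ`-polynomial is dominated by a single power of `t + 2`: `q(t) ≤ c (t+2)^d`. [cite: AroraBarakCC2009, Def. 1.13] -/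
theorem exists_eval_le_mul_pow (q : Polynomial ℕ) : ∃ c d : ℕ, ∀ t : ℕ, q.eval t ≤ c * (t + 2) ^ d := by
  obtain ⟨c, d, h⟩ := exists_eval_le_mul_pow_add q
  refine ⟨2 * c, d, fun t => (h t).trans ?_⟩
  have h1 : t ^ d ≤ (t + 2) ^ d := Nat.pow_le_pow_left (by omega) d
  have h2 : 1 ≤ (t + 2) ^ d := Nat.one_le_pow d _ (by omega)
  nlinarith

/-- Monotonicity of evaluation of `ℕ`-polynomials. [folklore] -/
theorem eval_mono (q : Polynomial ℕ) {a b : ℕ} (h : a ≤ b) : q.eval a ≤ q.eval b := by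
  induction q using Polynomial.induction_on' with
  | add p q hp hq => simp only [eval_add]; exact Nat.add_le_add hp hq
  | monomial n c => simp only [eval_monomial]; exact Nat.mul_le_mul_left c (Nat.pow_le_pow_left h n)

/-- `Nat.pair a b ≤ (a + b + 1)²`. [folklore] -/
theorem pair_le_sq (a b : ℕ) : Nat.pair a b ≤ (a + b + 1) ^ 2 :=
  (Nat.pair_lt_max_add_one_sq a b).le.trans (Nat.pow_le_pow_left (by omega) 2)

/-! ### The slack -/

/-- **The sample length plus the index is polynomial, with the slack constant only in the leading
constant**: for `n ≤ Y`, `k ≤ (E+1)Y`, `t + 1 ≤ Y` one has `(n+1)k + ⟨n,k,t⟩ ≤ 5 (E+2)^4 Y^4`.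
[folklore] -/
theorem sample_add_index_le {n k t Y E : ℕ} (hn : n + 1 ≤ Y) (hk : k ≤ (E + 1) * Y) (ht : t + 1 ≤ Y) :
    (n + 1) * k + Nat.pair n (Nat.pair k t) ≤ 5 * (E + 2) ^ 4 * Y ^ 4 := by
  have hY : 1 ≤ Y := by omega
  have h1 : (n + 1) * k ≤ (E + 1) * Y ^ 2 := by
    calc (n + 1) * k ≤ Y * ((E + 1) * Y) := Nat.mul_le_mul hn hk
      _ = (E + 1) * Y ^ 2 := by ring
  have h2 : Nat.pair k t ≤ ((E + 2) * Y) ^ 2 := by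
    refine (pair_le_sq k t).trans (Nat.pow_le_pow_left ?_ 2)
    nlinarith
  have h3 : Nat.pair n (Nat.pair k t) ≤ (2 * (E + 2) ^ 2 * Y ^ 2) ^ 2 := by
    refine (pair_le_sq n _).trans (Nat.pow_le_pow_left ?_ 2)
    have : n + ((E + 2) * Y) ^ 2 + 1 ≤ 2 * (E + 2) ^ 2 * Y ^ 2 := by
      have hY2 : Y ≤ Y ^ 2 := by nlinarith
      have hE : 1 ≤ (E + 2) ^ 2 := Nat.one_le_pow _ _ (by omega)
      nlinarith
    exact (Nat.add_le_add_right (Nat.add_le_add_left h2 n) 1).trans this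
  have h4 : (2 * (E + 2) ^ 2 * Y ^ 2) ^ 2 = 4 * (E + 2) ^ 4 * Y ^ 4 := by ring
  have h5 : (E + 1) * Y ^ 2 ≤ (E + 2) ^ 4 * Y ^ 4 := by
    have hY4 : Y ^ 2 ≤ Y ^ 4 := Nat.pow_le_pow_right hY (by omega)
    have hE4 : E + 1 ≤ (E + 2) ^ 4 := by nlinarith [Nat.one_le_pow 3 (E + 2) (by omega)]
    exact Nat.mul_le_mul hE4 hY4
  rw [h4] at h3
  calc (n + 1) * k + Nat.pair n (Nat.pair k t) ≤ (E + 2) ^ 4 * Y ^ 4 + 4 * (E + 2) ^ 4 * Y ^ 4 :=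
        Nat.add_le_add (h1.trans h5) h3
    _ = 5 * (E + 2) ^ 4 * Y ^ 4 := by ring

/-- **The slack of the proof of Thm. 4.2** ("choosing the constant `d` large enough … for all large
`t`"): for all polynomials `p_L` (the ensemble bound), `q_κ` (a bound on the estimated log-size) and
`q₁` (the inverse success of the heuristic) there are a slack constant `E` and a threshold `T₀` with
`2 q₁((n+1)k + ⟨n,k,t⟩) ≤ (t+2)^E` whenever `t ≥ T₀`, `n ≤ p_L(t)` and `k ≤ q_κ(t) + E(t+3)`.
[cite: Hirahara2021, Thm. 4.2 (proof of Claim 4.7, "Choosing the constant d large enough")] -/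
theorem exists_slack (pL qκ q₁ : Polynomial ℕ) :
    ∃ E T₀ : ℕ, ∀ t n k : ℕ, T₀ ≤ t → n ≤ pL.eval t → k ≤ qκ.eval t + E * (t + 3) →
      2 * q₁.eval ((n + 1) * k + Nat.pair n (Nat.pair k t)) ≤ (t + 2) ^ E := by
  -- `Y(t) = p_L(t) + q_κ(t) + t + 4` dominates `n + 1`, `t + 1`, and `k ≤ (E+1) Y(t)`
  set Yp : Polynomial ℕ := pL + qκ + X + 4 with hYp
  -- `q₁(y) ≤ c_q (y+2)^{d_q}`; the argument is `≤ 5 (E+2)^4 Y^4`, so `q₁ ≤ c_q (5(E+2)^4 Y^4 + 2)^{d_q}`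
  obtain ⟨cq, dq, hq⟩ := exists_eval_le_mul_pow q₁
  -- `(5 Y^4 + 2)^{d_q} ≤ c_G (t+2)^{d_G}`
  obtain ⟨cG, dG, hG⟩ := exists_eval_le_mul_pow ((5 * Yp ^ 4 + 2) ^ dq)
  refine ⟨dG + 1, 2 * cq * cG * (dG + 1 + 2) ^ (4 * dq), fun t n k ht hn hk => ?_⟩
  set E := dG + 1 with hE
  set Y := Yp.eval t with hY
  have hYeval : Y = pL.eval t + qκ.eval t + t + 4 := by simp [hY, hYp]
  have hn' : n + 1 ≤ Y := by rw [hYeval]; omega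
  have ht' : t + 1 ≤ Y := by rw [hYeval]; omega
  have hk' : k ≤ (E + 1) * Y := by
    rw [hYeval]
    have : E * (t + 3) ≤ E * (pL.eval t + qκ.eval t + t + 4) := Nat.mul_le_mul_left E (by omega)
    nlinarith
  have harg := sample_add_index_le (E := E) hn' hk' ht'
  -- bound `q₁` at the argument
  have h1 : q₁.eval ((n + 1) * k + Nat.pair n (Nat.pair k t)) ≤ cq * (5 * (E + 2) ^ 4 * Y ^ 4 + 2) ^ dq :=
    (eval_mono q₁ harg).trans (hq _)
  -- `(5 (E+2)^4 Y^4 + 2) ≤ (E+2)^4 (5 Y^4 + 2)`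
  have h2 : 5 * (E + 2) ^ 4 * Y ^ 4 + 2 ≤ (E + 2) ^ 4 * (5 * Y ^ 4 + 2) := by
    have : 1 ≤ (E + 2) ^ 4 := Nat.one_le_pow _ _ (by omega)
    nlinarith
  have h3 : (5 * (E + 2) ^ 4 * Y ^ 4 + 2) ^ dq ≤ (E + 2) ^ (4 * dq) * (5 * Y ^ 4 + 2) ^ dq := by
    rw [pow_mul, ← mul_pow]
    exact Nat.pow_le_pow_left h2 dq
  -- `(5 Y^4 + 2)^{d_q}` is the evaluation of the polynomial `(5 Yp^4 + 2)^{d_q}` at `t`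
  have h4 : (5 * Y ^ 4 + 2) ^ dq ≤ cG * (t + 2) ^ dG := by
    have h := hG t
    simpa [hY] using h
  have hmain : 2 * q₁.eval ((n + 1) * k + Nat.pair n (Nat.pair k t)) ≤ (2 * cq * cG * (E + 2) ^ (4 * dq)) * (t + 2) ^ dG := by
    calc 2 * q₁.eval ((n + 1) * k + Nat.pair n (Nat.pair k t))
        ≤ 2 * (cq * ((E + 2) ^ (4 * dq) * (cG * (t + 2) ^ dG))) := by
          refine Nat.mul_le_mul_left 2 (h1.trans (Nat.mul_le_mul_left cq (h3.trans (Nat.mul_le_mul_left _ h4))))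
      _ = (2 * cq * cG * (E + 2) ^ (4 * dq)) * (t + 2) ^ dG := by ring
  refine hmain.trans ?_
  have hpow : (t + 2) ^ E = (t + 2) ^ dG * (t + 2) := by rw [hE, pow_succ]
  rw [hpow, mul_comm (2 * cq * cG * (E + 2) ^ (4 * dq))]
  exact Nat.mul_le_mul_left _ (by omega)

end LCBounds

end Literature.Computability.MetaComplexity
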